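import Literature.NumberTheory.EllipticCurves.Rank1Residual.CyclotomicWindingSpan
import HarnessLib

/-! # crux-triage r1 seat 2 (GEN 10) — Lean companion for the (W) stub `stub_flatWitnessAtTwo` of line
`kato_free_lower_sandwich_two` (v8): (T) trace lemma, (F3) two-elliptic witness, instances 365 / 20513 / 25009.

§T  `abs_trEntry_le_two_of_isOfFinOrder`: a finite-order element of `Γ₀(N)` has `|tr| ≤ 2` (so the killed residues are
    the roots of `x² − t x + 1`, `t ∈ {0, ±1, ±2}` — `dEntry_sq_sub_tr_mul_add_one`).  Absent from the tree; needed by (W) at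
    the 9708/14999 odd levels `< 30000` whose witness exponent `k` is even (a PROPER admissible `H` is then forced).
§F3 `exists_prodEll4`: for `N ∣ ℓ²+1`, `N ∣ (q−ℓ)²+1`, `ρ = ε(ℓ,−1,ℓ²+1)·ε(q−ℓ,1,−((q−ℓ)²+1))` is a product of two order-4
    elements with `d(ρ) = ℓq+1`; `flatW_of_prodEll4_odd`: with `ℓq+1 = 2ᵏ`, `k` odd, `H = ⊤` this IS the (W) conclusion.
    On paper (TRIAGE-r1-2.md §N1): with Dirichlet (`Nat.forall_exists_prime_gt_and_eq_mod`, in Mathlib) such `ℓ, q, k` with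
    `v₂(k) = v₂(r_G)` exist at EVERY level of the residual class C3, so (W) holds at every odd `N`.
§I  `flatW_365` (smallest C3 level, `k = 18`, proper `H` = the 8 residues `±1, ±i₁, ±i₂, ±2¹⁸`, via §T), `flatW_20513`
    (`k = 315`), `flatW_25009` (`k = 385`) — the two C3 levels `< 30000` with odd `r_G`.
BSD is not proved here; these are witnesses for one elementary stub of one line.
-/

noncomputable section

open scoped Classical MatrixGroups ModularForm

open CongruenceSubgroup Literature.NumberTheory.EllipticCurves.Rank1Residual
  Literature.NumberTheory.EllipticCurves.ModularForms

namespace TriageR1Seat2Gen10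

/-! ## §T — the trace lemma -/


/-- `u₀ = 0`, `u₁ = 1`, `uₙ₊₂ = t·uₙ₊₁ − uₙ`. -/
def useq (t : ℤ) : ℕ → ℤ
  | 0 => 0
  | 1 => 1
  | (n + 2) => t * useq t (n + 1) - useq t n

@[simp] theorem useq_zero (t : ℤ) : useq t 0 = 0 := rfl
@[simp] theorem useq_one (t : ℤ) : useq t 1 = 1 := rfl
theorem useq_succ_succ (t : ℤ) (n : ℕ) : useq t (n + 2) = t * useq t (n + 1) - useq t n := rfl

theorem abs_useq_lt (t : ℤ) (ht : 3 ≤ |t|) : ∀ n : ℕ, |useq t n| < |useq t (n + 1)|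
  | 0 => by simp
  | (n + 1) => by
      have ih := abs_useq_lt t ht n
      rw [show n + 1 + 1 = n + 2 from rfl, useq_succ_succ]
      have h1 : |t * useq t (n + 1)| - |useq t n| ≤ |t * useq t (n + 1) - useq t n| := abs_sub_abs_le_abs_sub _ _
      rw [abs_mul] at h1
      nlinarith [abs_nonneg (useq t n), abs_nonneg (useq t (n + 1)), h1, ih, ht]

/-- `Mⁿ⁺¹ = uₙ₊₁·M − uₙ·I` for a `2 × 2` integer matrix of determinant `1` (`t = tr M`), entrywise. -/
theorem pow_succ_eq_useq (M : Matrix (Fin 2) (Fin 2) ℤ) (hdet : M.det = 1) : ∀ n : ℕ,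
    M ^ (n + 1) = !![useq (M 0 0 + M 1 1) (n + 1) * M 0 0 - useq (M 0 0 + M 1 1) n, useq (M 0 0 + M 1 1) (n + 1) * M 0 1;
      useq (M 0 0 + M 1 1) (n + 1) * M 1 0, useq (M 0 0 + M 1 1) (n + 1) * M 1 1 - useq (M 0 0 + M 1 1) n]
  | 0 => by
      rw [zero_add, pow_one]
      ext i j
      fin_cases i <;> fin_cases j <;> simp
  | (n + 1) => by
      rw [Matrix.det_fin_two] at hdet
      rw [pow_succ, pow_succ_eq_useq M (by rw [Matrix.det_fin_two]; exact hdet) n,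
        show n + 1 + 1 = n + 2 from rfl, useq_succ_succ]
      ext i j
      fin_cases i <;> fin_cases j <;> simp [Matrix.mul_apply, Fin.sum_univ_two] <;>
        first | ring1 | linear_combination (-(useq (M 0 0 + M 1 1) (n + 1))) * hdet

/-- (T) An element of finite order of `Γ₀(N)` has `|trace| ≤ 2`. [folklore] -/
theorem abs_trEntry_le_two_of_isOfFinOrder {N : ℕ} {γ : Gamma0 N} (hγ : IsOfFinOrder γ) : |trEntry γ| ≤ 2 := by
  by_contra hlt
  have ht : 3 ≤ |trEntry γ| := by omega
  obtain ⟨n, hn, hpow⟩ := hγ.exists_pow_eq_one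
  set M : Matrix (Fin 2) (Fin 2) ℤ := ((γ : SL(2, ℤ)) : Matrix (Fin 2) (Fin 2) ℤ) with hM
  have hdet : M.det = 1 := (γ : SL(2, ℤ)).det_coe
  have ht' : trEntry γ = M 0 0 + M 1 1 := rfl
  have hMn : M ^ n = 1 := by
    have h := congrArg (fun g : Gamma0 N => ((g : SL(2, ℤ)) : Matrix (Fin 2) (Fin 2) ℤ)) hpow
    simpa [Matrix.SpecialLinearGroup.coe_pow] using h
  obtain ⟨m, rfl⟩ : ∃ m, n = m + 1 := ⟨n - 1, by omega⟩
  rw [pow_succ_eq_useq M hdet m] at hMn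
  have hu : useq (M 0 0 + M 1 1) (m + 1) ≠ 0 := by
    have h := abs_useq_lt (M 0 0 + M 1 1) (ht' ▸ ht) m
    intro h0
    rw [h0, abs_zero] at h
    exact absurd h (not_lt.2 (abs_nonneg _))
  have h01 : M 0 1 = 0 := by
    have h := congrFun (congrFun hMn 0) 1
    simpa [hu] using h
  have h10 : M 1 0 = 0 := by
    have h := congrFun (congrFun hMn 1) 0
    simpa [hu] using h
  rw [Matrix.det_fin_two, h01, h10, mul_zero, sub_zero] at hdet
  rcases Int.eq_one_or_neg_one_of_mul_eq_one' hdet with ⟨ha, hd⟩ | ⟨ha, hd⟩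
  · rw [ht', ha, hd] at ht
    norm_num at ht
  · rw [ht', ha, hd] at ht
    norm_num at ht

/-- (T′) hence the trace of a finite-order element is one of `0, ±1, ±2`. -/
theorem trEntry_mem_of_isOfFinOrder {N : ℕ} {γ : Gamma0 N} (hγ : IsOfFinOrder γ) :
    trEntry γ = 0 ∨ trEntry γ = 1 ∨ trEntry γ = -1 ∨ trEntry γ = 2 ∨ trEntry γ = -2 := by
  have h := abs_trEntry_le_two_of_isOfFinOrder hγ
  rw [abs_le] at h
  omega

/-- The `d`-entry of ANY `γ ∈ Γ₀(N)` satisfies `d² − t·d + 1 ≡ 0 (mod N)` (`t` the trace): `ad − bc = 1`, `N ∣ c`.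
With (T′) the killed residues are exactly roots of `x² − t x + 1`, `t ∈ {0, ±1, ±2}`. -/
theorem dEntry_sq_sub_tr_mul_add_one {N : ℕ} (γ : Gamma0 N) :
    ((dEntry γ ^ 2 - trEntry γ * dEntry γ + 1 : ℤ) : ZMod N) = 0 := by
  have hdet : ((γ : SL(2, ℤ)) : Matrix (Fin 2) (Fin 2) ℤ).det = 1 := (γ : SL(2, ℤ)).det_coe
  rw [Matrix.det_fin_two] at hdet
  have hc : ((((γ : SL(2, ℤ)) : Matrix (Fin 2) (Fin 2) ℤ) 1 0 : ℤ) : ZMod N) = 0 := Gamma0_mem.1 γ.2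
  have e : (dEntry γ ^ 2 - trEntry γ * dEntry γ + 1 : ℤ)
      = -(((γ : SL(2, ℤ)) : Matrix (Fin 2) (Fin 2) ℤ) 0 1) * ((γ : SL(2, ℤ)) : Matrix (Fin 2) (Fin 2) ℤ) 1 0 := by
    simp only [dEntry, trEntry]
    linear_combination (-1 : ℤ) * hdet
  rw [e]
  push_cast
  rw [hc, mul_zero]


/-! ## §F3 — the two-elliptic witness and the k-odd family -/


/-- The (W) conclusion at level `N`, verbatim from `Lines/kato_free_lower_sandwich_two.lean` v8 `stub_flatWitnessAtTwo`. -/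
def FlatW (N : ℕ) : Prop :=
    ∃ (H : Subgroup (ZMod N)ˣ) (ρ : Gamma0 N) (k : ℕ), -1 ∈ H ∧
      (∀ γ : Gamma0 N, IsOfFinOrder γ ∨ trEntry γ = 2 ∨ trEntry γ = -2 → ∃ u ∈ H, (u : ZMod N) = Gamma0Map N γ) ∧
      ρ ∈ Subgroup.closure {γ : Gamma0 N | IsOfFinOrder γ ∨ trEntry γ = 2 ∨ trEntry γ = -2} ⊔ commutator (Gamma0 N) ∧
      (dEntry ρ).natAbs = 2 ^ k ∧
      ∀ e : ℕ, (∃ u ∈ H, (u : ZMod N) = 2 ^ e) → Nat.gcd k 4 ∣ e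

/-- The trace-zero matrix `(a, b; c, −a)`. -/
def ellMat (a b c : ℤ) : Matrix (Fin 2) (Fin 2) ℤ := !![a, b; c, -a]

theorem ellMat_det {a b c : ℤ} (h : a * a + b * c = -1) : (ellMat a b c).det = 1 := by
  rw [ellMat, Matrix.det_fin_two_of]
  linear_combination (-1 : ℤ) * h

theorem ellMat_sq {a b c : ℤ} (h : a * a + b * c = -1) : ellMat a b c ^ 2 = -1 := by
  ext i j
  fin_cases i <;> fin_cases j <;>
    simp [ellMat, pow_two, Matrix.mul_apply, Fin.sum_univ_two] <;> linarith [h, mul_comm b c, mul_comm a b, mul_comm c a]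

/-- `ε(a,b,c) ∈ Γ₀(N)` (order `4`). -/
def ell (N : ℕ) (a b c : ℤ) (h : a * a + b * c = -1) (hc : (N : ℤ) ∣ c) : Gamma0 N :=
  ⟨⟨ellMat a b c, ellMat_det h⟩, by
    rw [Gamma0_mem]
    simp [ellMat, (ZMod.intCast_zmod_eq_zero_iff_dvd c N).2 hc]⟩

theorem ell_pow_four (N : ℕ) (a b c : ℤ) (h : a * a + b * c = -1) (hc : (N : ℤ) ∣ c) :
    ell N a b c h hc ^ 4 = 1 := by
  apply Subtype.ext
  rw [Subgroup.coe_pow, Subgroup.coe_one]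
  apply Subtype.ext
  rw [Matrix.SpecialLinearGroup.coe_pow, Matrix.SpecialLinearGroup.coe_one]
  show ellMat a b c ^ 4 = 1
  rw [show (4 : ℕ) = 2 * 2 from rfl, pow_mul, ellMat_sq h]
  simp

theorem ell_isOfFinOrder (N : ℕ) (a b c : ℤ) (h : a * a + b * c = -1) (hc : (N : ℤ) ∣ c) :
    IsOfFinOrder (ell N a b c h hc) :=
  isOfFinOrder_iff_pow_eq_one.2 ⟨4, by norm_num, ell_pow_four N a b c h hc⟩

theorem dEntry_ell_mul_ell (N : ℕ) (a₁ b₁ c₁ a₂ b₂ c₂ : ℤ) (h₁ : a₁ * a₁ + b₁ * c₁ = -1) (hc₁ : (N : ℤ) ∣ c₁)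
    (h₂ : a₂ * a₂ + b₂ * c₂ = -1) (hc₂ : (N : ℤ) ∣ c₂) :
    dEntry (ell N a₁ b₁ c₁ h₁ hc₁ * ell N a₂ b₂ c₂ h₂ hc₂) = c₁ * b₂ + a₁ * a₂ := by
  simp [dEntry, ell, ellMat, Matrix.mul_apply, Fin.sum_univ_two]

/-- (F3) The two-elliptic witness: `ρ = ε(ℓ,−1,ℓ²+1)·ε(q−ℓ,1,−((q−ℓ)²+1))` is a product of two elements of order `4`
of `Γ₀(N)` with `d(ρ) = ℓq + 1`. -/
theorem exists_prodEll4 (N : ℕ) (ℓ q : ℤ) (h₁ : (N : ℤ) ∣ ℓ ^ 2 + 1) (h₂ : (N : ℤ) ∣ (q - ℓ) ^ 2 + 1) :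
    ∃ ρ : Gamma0 N, ρ ∈ Subgroup.closure {γ : Gamma0 N | IsOfFinOrder γ ∨ trEntry γ = 2 ∨ trEntry γ = -2} ∧
      dEntry ρ = ℓ * q + 1 := by
  have e₁ : ℓ * ℓ + (-1) * (ℓ ^ 2 + 1) = -1 := by ring
  have e₂ : (q - ℓ) * (q - ℓ) + 1 * (-((q - ℓ) ^ 2 + 1)) = -1 := by ring
  have hc₂ : (N : ℤ) ∣ -((q - ℓ) ^ 2 + 1) := (dvd_neg).2 h₂
  refine ⟨ell N ℓ (-1) (ℓ ^ 2 + 1) e₁ h₁ * ell N (q - ℓ) 1 (-((q - ℓ) ^ 2 + 1)) e₂ hc₂, ?_, ?_⟩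
  · exact Subgroup.mul_mem _ (Subgroup.subset_closure (Or.inl (ell_isOfFinOrder N _ _ _ e₁ h₁)))
      (Subgroup.subset_closure (Or.inl (ell_isOfFinOrder N _ _ _ e₂ hc₂)))
  · rw [dEntry_ell_mul_ell]
    ring

/-- (W) at every level admitting an (F3) witness with `k` odd (then `H = ⊤`, `gcd(k,4) = 1`). -/
theorem flatW_of_prodEll4_odd (N : ℕ) (ℓ q : ℤ) (k : ℕ) (hk : Odd k) (h₁ : (N : ℤ) ∣ ℓ ^ 2 + 1)
    (h₂ : (N : ℤ) ∣ (q - ℓ) ^ 2 + 1) (hd : ℓ * q + 1 = 2 ^ k) : FlatW N := by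
  obtain ⟨ρ, hρ, hdρ⟩ := exists_prodEll4 N ℓ q h₁ h₂
  have hg : Nat.gcd k 4 = 1 := by
    have : Nat.Coprime k (2 ^ 2) := Nat.Coprime.pow_right 2 (Nat.coprime_two_right.2 hk)
    simpa using this
  refine ⟨⊤, ρ, k, Subgroup.mem_top _, ?_, Subgroup.mem_sup_left hρ, ?_, ?_⟩
  · intro γ _
    exact ⟨(isUnit_Gamma0Map N γ).unit, Subgroup.mem_top _, (isUnit_Gamma0Map N γ).unit_spec⟩
  · rw [hdρ, hd]
    simp
  · intro e _
    simp [hg]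

set_option exponentiation.threshold 1024 in
/-- `N = 20513 = 73·281` (C3, `v₂ r_G = 0`): `k = 315`, `ℓ = 34912486973108831927 ∣ 2³¹⁵ − 1`, `ℓ² ≡ −1 (mod N)`. -/
theorem flatW_20513 : FlatW 20513 :=
  flatW_of_prodEll4_odd 20513 34912486973108831927 1911911773112639638257906496058954152649576770602061843128553421827395356921 315
    ⟨157, by norm_num⟩ (by norm_num) (by decide) (by decide)

set_option exponentiation.threshold 1024 in
/-- `N = 25009 = 89·281` (C3, `v₂ r_G = 0`): `k = 385`, `ℓ = 274765198491814784087 ∣ 2³⁸⁵ − 1`, `ℓ² ≡ −1 (mod N)`. -/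
theorem flatW_25009 : FlatW 25009 :=
  flatW_of_prodEll4_odd 25009 274765198491814784087 286804925897980921582923899491580559323803798044058089486673652950463239719794398682934102671513 385
    ⟨192, by norm_num⟩ (by norm_num) (by decide) (by decide)

/-- `N = 365 = 5·73` (the smallest C3 level, `v₂ r_G = 1`): the `ρ`-part with `k = 18` (`ℓ = 27`, `q = 9709`,
`27·9709 + 1 = 2¹⁸`); the `H`-part (an admissible `H` with `ord(2 mod H)` even) needs the trace lemma (T). -/
theorem rho_365 : ∃ ρ : Gamma0 365,
    ρ ∈ Subgroup.closure {γ : Gamma0 365 | IsOfFinOrder γ ∨ trEntry γ = 2 ∨ trEntry γ = -2} ∧ dEntry ρ = 2 ^ 18 := by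
  obtain ⟨ρ, hρ, hd⟩ := exists_prodEll4 365 27 9709 (by norm_num) (by norm_num)
  exact ⟨ρ, hρ, by rw [hd]; norm_num⟩


/-! ## §I — the smallest C3 level `N = 365 = 5·73` in full: proper admissible `H` via (T). -/

/-- The 8 residues `±1, ±i₁, ±i₂, ±ζ` mod `365` (`i² ≡ −1`, `ζ = 2¹⁸ ≡ 74 = i₁i₂`): the group `G_365 = ⟨−1, killed⟩`. -/
def S365 : Finset (ZMod 365) := {1, 27, 74, 173, 192, 291, 338, 364}

theorem S365_mul : ∀ a ∈ S365, ∀ b ∈ S365, a * b ∈ S365 := by decide +kernel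

theorem S365_inv : ∀ a ∈ S365, ∃ b ∈ S365, a * b = 1 := by decide +kernel

/-- every root of `x² − t x + 1`, `t ∈ {0, ±1, ±2}`, mod `365` lies in `S365` (the killed residues, by (T)). -/
theorem S365_cover : ∀ d : ZMod 365, ∀ t ∈ ({0, 1, -1, 2, -2} : Finset (ZMod 365)),
    d ^ 2 - t * d + 1 = 0 → d ∈ S365 := by
  decide +kernel

theorem S365_two_mul_four_pow : ∀ j < 18, (4 : ZMod 365) ^ j * 2 ∉ S365 := by decide +kernel

/-- `H = G_365` as a subgroup of `(ℤ/365)ˣ`. -/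
def H365 : Subgroup (ZMod 365)ˣ where
  carrier := {u | (u : ZMod 365) ∈ S365}
  mul_mem' := by
    intro u v hu hv
    simp only [Set.mem_setOf_eq, Units.val_mul] at *
    exact S365_mul _ hu _ hv
  one_mem' := by
    show ((1 : (ZMod 365)ˣ) : ZMod 365) ∈ S365
    decide
  inv_mem' := by
    intro u hu
    simp only [Set.mem_setOf_eq] at *
    obtain ⟨b, hb, hab⟩ := S365_inv _ hu
    rw [Units.inv_eq_of_mul_eq_one_right hab]
    exact hb

/-- admissibility of `H365`: the `d`-residue of every finite-order / trace-`±2` element of `Γ₀(365)` lies in it — via (T). -/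
theorem H365_admissible (γ : Gamma0 365) (h : IsOfFinOrder γ ∨ trEntry γ = 2 ∨ trEntry γ = -2) :
    ∃ u ∈ H365, (u : ZMod 365) = Gamma0Map 365 γ := by
  refine ⟨(isUnit_Gamma0Map 365 γ).unit, ?_, (isUnit_Gamma0Map 365 γ).unit_spec⟩
  show ((isUnit_Gamma0Map 365 γ).unit : ZMod 365) ∈ S365
  rw [IsUnit.unit_spec, ← intCast_dEntry]
  have ht : trEntry γ = 0 ∨ trEntry γ = 1 ∨ trEntry γ = -1 ∨ trEntry γ = 2 ∨ trEntry γ = -2 := by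
    rcases h with h | h | h
    · exact trEntry_mem_of_isOfFinOrder h
    · exact Or.inr (Or.inr (Or.inr (Or.inl h)))
    · exact Or.inr (Or.inr (Or.inr (Or.inr h)))
  have hq : ((dEntry γ : ℤ) : ZMod 365) ^ 2 - ((trEntry γ : ℤ) : ZMod 365) * ((dEntry γ : ℤ) : ZMod 365) + 1 = 0 := by
    have h0 := dEntry_sq_sub_tr_mul_add_one γ
    push_cast at h0
    exact h0
  have ht' : ((trEntry γ : ℤ) : ZMod 365) ∈ ({0, 1, -1, 2, -2} : Finset (ZMod 365)) := by
    rcases ht with e | e | e | e | e <;> rw [e] <;> decide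
  exact S365_cover _ _ ht' hq

/-- `2ᵉ ∈ H365 ⇒ e` even (`ord(2 mod G_365) = 18`). -/
theorem H365_two_pow (e : ℕ) (h : ∃ u ∈ H365, (u : ZMod 365) = 2 ^ e) : 2 ∣ e := by
  obtain ⟨u, hu, hue⟩ := h
  have hmem : (2 : ZMod 365) ^ e ∈ S365 := by
    have hu' : (u : ZMod 365) ∈ S365 := hu
    rwa [hue] at hu'
  by_contra hodd
  have he : e = 2 * (e / 2) + 1 := by omega
  have h4 : (2 : ZMod 365) ^ 2 = 4 := by norm_num
  have h18 : (4 : ZMod 365) ^ 18 = 1 := by decide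
  rw [he, pow_succ, pow_mul, h4, ← Nat.mod_add_div (e / 2) 18, pow_add, pow_mul, h18, one_pow, mul_one] at hmem
  exact S365_two_mul_four_pow _ (Nat.mod_lt _ (by norm_num)) hmem

/-- **(W) at `N = 365`** (smallest level needing a product witness AND a proper `H`): `ρ` = (F3) with `ℓ = 27`, `q = 9709`
(`27·9709 + 1 = 2¹⁸`), `H = G_365`, `gcd(18,4) = 2 ∣ e` whenever `2ᵉ ∈ H`. -/
theorem flatW_365 : FlatW 365 := by
  obtain ⟨ρ, hρ, hd⟩ := exists_prodEll4 365 27 9709 (by norm_num) (by norm_num)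
  refine ⟨H365, ρ, 18, ?_, H365_admissible, Subgroup.mem_sup_left hρ, ?_, fun e he => ?_⟩
  · show ((-1 : (ZMod 365)ˣ) : ZMod 365) ∈ S365
    decide
  · rw [hd]
    norm_num
  · have h2 := H365_two_pow e he
    have hg : Nat.gcd 18 4 = 2 := by decide
    rw [hg]
    exact h2

end TriageR1Seat2Gen10
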